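import Summits.QuantumFields.YangMills.Theorems.FluctuationComparisonRegPrIntLS2BetaWhitneyHatCurlSq
import Summits.QuantumFields.YangMills.Theorems.FluctuationComparisonRegPrIntLS2BetaWhitneyHatLift
import Summits.QuantumFields.YangMills.Theorems.FluctuationComparisonRegPrIntLS2BetaSU2FourFactorExpansion
import Summits.QuantumFields.YangMills.Theorems.FluctuationComparisonRegPrIntLS2BetaRowTransportVariance
import Summits.QuantumFields.YangMills.Theorems.FluctuationComparisonRegPrIntLS2BetaRelativeFieldSquareSumPlaq
import HarnessLib

/-!
# S2β · `hFlat` road, (F3) in `ℓ²` — THE CURVATURE OF THE GEODESIC WHITNEY HAT LIFT SUMMED OVER A LEVEL: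
# `Σ_{p : Plaq P t} dist1 (V(∂p))² ≤ (L⁻¹)⁴·L^d·(π²·Σ_{p′} dist1 (X(∂p′))² + 6912(d−1)·s²·Σ_e arc(X e)²)` — the `L^{d−4}` gain on the coarse FLUX + SIZE² linear in `‖arc X‖²_{ℓ²}`

Cell `ym3-torus` (rung R3 = continuum `SU(2)` Yang–Mills on the three-torus — NOT d = 4, NOT infinite volume, NOT a mass gap, NOT Clay).
Width seat «width 12» `ym3-torus-px12` (gen 23), FREE px helper on crux `stmt-QuantumFields-20520` (`Theses.UnitScaleTilt.FluctuationComparisonRegPrIntL`),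
count-neutral, DEFINITION-FREE (lift `V` and weights `w` pinned by the displayed formulas `hV`, `hw` of ✓`…S2BetaWhitneyHatLift`).

WHAT IT IS FOR (UV3-NODE §57.8 (B), §64.6 (3) «F3 (ii-c)×(5) (px12∕px16∕px17)»; px17 g19's door ✓p816498 (H); px13 g22's ✓`sq_sum_le_plaq` carries `Σ_p dist1 (plaqHol U₀ p)²`
with `U₀ := V` — «the lift's own plaquettes are px12's (ii-c) business»).  THIS FILE is that term in `ℓ²`, with NO sup-only junk: every SIZE² contribution is LOCAL, so the
level sum is linear in the coarse field's squared `ℓ²`-size `Σ_e arc(X e)² = B_{t+1}²` (times `s²`, `s` the sup of the coarse arcs — after ✓p814387∕✓p815840 and along the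
CONTRACTING relative tower ✓p816141 (5) the `s` is `s′_{t+1}`, summable), and the FLUX contribution is the coarse plaquette energy with the gain `(L⁻¹)⁴·L^d` (= `L⁻¹` in `d = 3`).
* §1 `rect_one_one_eq`, `sq_norm_exponent_le` (Jensen for the exponents: `‖a b‖² ≤ (L⁻¹)²·Σ_e w b e·arc(X e)²`), ★★`dist1_rect_lift_sq_le` (ONE fine position, local:
  `dist1 (R_{μκ}V(x))² ≤ 2‖da(x)‖² + 1152·(L⁻¹)²·s²·Σ_{i=1}^4 ‖a b_i‖²`, via ✓`dist1_plaq4_le` with `τ_x := √(Σ_i ‖a b_i‖²) ≤ 2L⁻¹s ≤ 1∕4`), ★★`sq_norm_lincurl_coarse_le`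
  (ONE coarse position: `‖dA(y)‖² ≤ (L⁻¹)²·(2·arc(R_{μκ}X(y))² + 1152·s²·Σ_{edges} arc²)`, via ✓`norm_lincurl_logVec_le_arc_add` with the local `σ_y`);
* §3 ★★★`sum_dist1_rect_lift_sq_le` (ONE PLANE `μ ≠ κ`, summed over the level; ✓`…WhitneyHatCurlSq.sum_sq_norm_lincurl_hat_le` + `sum_four_slots_eq`);
* §4 `sum_sum_hatW_mul_eq` (`Σ_b Σ_e w b e·G e = L^d·Σ_e G e`, ✓`sum_hatW_eq_pow`), ★★★`sum_positions_dist1_lift_sq_le` (ALL ordered positions `(x; μ ≠ κ)`, px13's currency: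
  `≤ (L⁻¹)⁴·L^d·(4·Σ_{(y;μ≠κ)} arc(R X)² + 13824(d−1)·s²·Σ_e arc(X e)²)`);
* §5 `sum_positions_arc_sq_le` (Jordan ✓`norm_logVec_le_pi_div_two_mul_dist1` + ✓`sum_positions_sq_eq_two_mul_sum_plaq`), ★★★`sum_plaq_dist1_lift_sq_le` — THE `Plaq P t` FORM
  above, docking by `exact` into ✓`sq_sum_le_plaq`'s `U₀`-term.
Constants crude but polynomial (`6912(d−1)`, smallness `s ≤ 1∕8`), as (B) allows.

HONEST SCOPE.  Bookkeeping over the companions; nothing of Bałaban's analysis is asserted ([Balaban1985RegularSpaces] (1.29) p.81: geodesic interpolation; [Balaban1985Variational]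
(34) p.283: plaquette expansion); (H), the recursions' premises, `hFlat`, TUBE-REG∘, GAP♯∘ (`stub_uniformFibreGapOrbit`), S2β, crux 20520 and `YM3TorusSU2` are NOT proved; no
registered stub is closed; the Yang–Mills mass gap is NOT proved.
References: T. Bałaban, CMP **99** (1985) 75–102 [Balaban1985RegularSpaces] ((1.29) p.81); CMP **102** (1985) 277–309 [Balaban1985Variational] ((34) p.283);
CMP **98** (1985) 17–51 [Balaban1985Averaging] ((9) p.19).
-/

set_option autoImplicit false

noncomputable section

namespace Summit.QuantumFields.YangMills.Theorems.FluctuationComparisonRegPrIntLS2BetaWhitneyHatLiftCurvatureSq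

open Finset
open scoped Real
open Literature.MathematicalPhysics.QuantumLattice (su2Quat)
open Literature.MathematicalPhysics.QuantumFieldTheory.Balaban1983to89
open B10Eq27TorusAxialLog (rel rel_apply)
open B10Eq47AxialChi (shiftN shiftN_zero shiftN_succ rowProd rect)
open T4CubeChartGnomonic (SU2)
open T4HaarSU2ExpChart (expPoint)
open T4ExpWindowSmallField (logVec)
open Summit.QuantumFields.YangMills.Theorems.FluctuationComparisonRegPrIntLS2BetaWhitneyHatWeights (hatW_nonneg sum_hatW_eq_one sum_hatW_eq_pow)
open Summit.QuantumFields.YangMills.Theorems.FluctuationComparisonRegPrIntLS2BetaGeodesicJensenLift (sq_norm_sum_smul_le)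
open Summit.QuantumFields.YangMills.Theorems.FluctuationComparisonRegPrIntLS2BetaSU2FourFactorExpansion
  (dist1_plaq4_le norm_lincurl_logVec_le_arc_add)
open Summit.QuantumFields.YangMills.Theorems.FluctuationComparisonRegPrIntLS2BetaWhitneyHatCurlSq
  (sum_sq_norm_lincurl_hat_le sum_shift_eq sum_four_slots_eq sum_ne_pair_eq sum_pairs_eq sum_pairs_add_eq sum_positions_eq)
open Summit.QuantumFields.YangMills.Theorems.FluctuationComparisonRegPrIntLS2BetaRelativeFieldSquareSumPlaq (sum_positions_sq_eq_two_mul_sum_plaq)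
open Summit.QuantumFields.YangMills.Theorems.FluctuationComparisonRegPrIntLS2BetaDistributedHolonomySU2 (norm_logVec_le_pi_div_two_mul_dist1)

variable {P : Params} {t : ℕ}

/-! ## §1 One position: the unit-rectangle word of the lift to second order, LOCAL sizes -/

/-- The `1 × 1` rectangle holonomy in either order of the axes is the four-bond word `U⟨x,μ⟩·U⟨x+e_μ,κ⟩·U⟨x+e_κ,μ⟩⁻¹·U⟨x,κ⟩⁻¹`. [cite: Balaban1985Averaging, (9) p.19] -/
theorem rect_one_one_eq {G : Type*} [GaugeGroup G] (U : GaugeField P t G) (x : Site P t) (μ κ : Fin P.d) :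
    rect U x μ κ 1 1 = U ⟨x, μ⟩ * U ⟨x.shift μ, κ⟩ * (U ⟨x.shift κ, μ⟩)⁻¹ * (U ⟨x, κ⟩)⁻¹ := by
  simp [rect, rowProd, shiftN]

/-- Jensen for the exponents of the lift: `‖Σ_e w b e • (L⁻¹ • log X e)‖² ≤ (L⁻¹)² · Σ_e w b e · arc(X e)²`. [folklore] -/
theorem sq_norm_exponent_le (ht : t + 1 ≤ P.m + P.K) (w : PBond P t → PBond P (t + 1) → ℝ)
    (hw : ∀ b e, w b e = if e.dir = b.dir ∧ (b.src b.dir - emb e.src b.dir).val < P.L then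
      ∏ ν ∈ Finset.univ.erase b.dir, max 0 (1 - ((rel (emb e.src) b.src ν).natAbs : ℝ) / P.L) else 0)
    (X : GaugeField P (t + 1) SU2) (b : PBond P t) :
    ‖∑ e, w b e • ((P.L : ℝ)⁻¹ • logVec (su2Quat (X e)))‖ ^ 2 ≤ ((P.L : ℝ)⁻¹) ^ 2 * ∑ e, w b e * ‖logVec (su2Quat (X e))‖ ^ 2 := by
  refine (sq_norm_sum_smul_le Finset.univ (fun e _ => hatW_nonneg w hw b e) (sum_hatW_eq_one ht w hw b) _).trans (le_of_eq ?_)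
  rw [Finset.mul_sum]
  refine Finset.sum_congr rfl fun e _ => ?_
  rw [norm_smul, mul_pow, Real.norm_eq_abs, abs_of_nonneg (inv_nonneg.mpr (Nat.cast_nonneg _))]; ring

/-- ★★ **ONE FINE POSITION, LOCAL FORM IN `ℓ²` CURRENCY**: with `τ_x² := Σ_{i=1}^{4} ‖a b_i‖²` (the four exponents of the lift around the unit rectangle, each `≤ τ_x`),
`dist1 (rect V x μ κ 1 1)² ≤ 2·‖d a(x;μ,κ)‖² + 288·τ_x⁴`, and `τ_x⁴ ≤ (2L⁻¹s)²·τ_x²` when every coarse bond is `s`-small, `s ≤ 1∕8`. [cite: Balaban1985Variational, (34) p.283] -/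
theorem dist1_rect_lift_sq_le (ht : t + 1 ≤ P.m + P.K) (w : PBond P t → PBond P (t + 1) → ℝ)
    (hw : ∀ b e, w b e = if e.dir = b.dir ∧ (b.src b.dir - emb e.src b.dir).val < P.L then
      ∏ ν ∈ Finset.univ.erase b.dir, max 0 (1 - ((rel (emb e.src) b.src ν).natAbs : ℝ) / P.L) else 0)
    (X : GaugeField P (t + 1) SU2) (V : GaugeField P t SU2)
    (hV : ∀ b, V b = expPoint (∑ e, w b e • ((P.L : ℝ)⁻¹ • logVec (su2Quat (X e)))))
    {s : ℝ} (hs : ∀ e, ‖logVec (su2Quat (X e))‖ ≤ s) (hs8 : s ≤ 1 / 8) (x : Site P t) (μ κ : Fin P.d) :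
    dist1 (rect V x μ κ 1 1) ^ 2 ≤
      2 * ‖(∑ e, w ⟨x, μ⟩ e • ((P.L : ℝ)⁻¹ • logVec (su2Quat (X e)))) + (∑ e, w ⟨x.shift μ, κ⟩ e • ((P.L : ℝ)⁻¹ • logVec (su2Quat (X e))))
            - (∑ e, w ⟨x.shift κ, μ⟩ e • ((P.L : ℝ)⁻¹ • logVec (su2Quat (X e)))) - (∑ e, w ⟨x, κ⟩ e • ((P.L : ℝ)⁻¹ • logVec (su2Quat (X e))))‖ ^ 2 +
      1152 * ((P.L : ℝ)⁻¹) ^ 2 * s ^ 2 *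
        (‖∑ e, w ⟨x, μ⟩ e • ((P.L : ℝ)⁻¹ • logVec (su2Quat (X e)))‖ ^ 2 + ‖∑ e, w ⟨x.shift μ, κ⟩ e • ((P.L : ℝ)⁻¹ • logVec (su2Quat (X e)))‖ ^ 2 +
          ‖∑ e, w ⟨x.shift κ, μ⟩ e • ((P.L : ℝ)⁻¹ • logVec (su2Quat (X e)))‖ ^ 2 + ‖∑ e, w ⟨x, κ⟩ e • ((P.L : ℝ)⁻¹ • logVec (su2Quat (X e)))‖ ^ 2) := by
  have hsq : ∀ u v : ℝ, (u + v) ^ 2 ≤ 2 * u ^ 2 + 2 * v ^ 2 := fun u v => by nlinarith [sq_nonneg (u - v)]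
  have hL1 : (1 : ℝ) ≤ P.L := by exact_mod_cast P.L_pos
  have hLinv0 : 0 ≤ (P.L : ℝ)⁻¹ := inv_nonneg.mpr (Nat.cast_nonneg _)
  have hLinv : (P.L : ℝ)⁻¹ ≤ 1 := inv_le_one_of_one_le₀ hL1
  have hs0 : 0 ≤ s := (norm_nonneg _).trans (hs ⟨blockOf x, μ⟩)
  -- the four exponents
  set a : PBond P t → EuclideanSpace ℝ (Fin 3) := fun b => ∑ e, w b e • ((P.L : ℝ)⁻¹ • logVec (su2Quat (X e))) with ha
  have hVa : ∀ b, V b = expPoint (a b) := fun b => by rw [hV]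
  have haL : ∀ b, ‖a b‖ ≤ (P.L : ℝ)⁻¹ * s := fun b =>
    FluctuationComparisonRegPrIntLS2BetaGeodesicJensenLift.norm_sum_smul_le_of_forall_le Finset.univ (fun e _ => hatW_nonneg w hw b e)
      (sum_hatW_eq_one ht w hw b) fun e _ => by
        rw [norm_smul, Real.norm_eq_abs, abs_of_nonneg hLinv0]; exact mul_le_mul_of_nonneg_left (hs e) hLinv0
  -- the local size τ_x
  set T : ℝ := ‖a ⟨x, μ⟩‖ ^ 2 + ‖a ⟨x.shift μ, κ⟩‖ ^ 2 + ‖a ⟨x.shift κ, μ⟩‖ ^ 2 + ‖a ⟨x, κ⟩‖ ^ 2 with hT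
  have hT0 : 0 ≤ T := by positivity
  set τ : ℝ := Real.sqrt T with hτ
  have q1 := sq_nonneg ‖a ⟨x, μ⟩‖; have q2 := sq_nonneg ‖a ⟨x.shift μ, κ⟩‖
  have q3 := sq_nonneg ‖a ⟨x.shift κ, μ⟩‖; have q4 := sq_nonneg ‖a ⟨x, κ⟩‖
  have hτ1 : ‖a ⟨x, μ⟩‖ ≤ τ := Real.le_sqrt_of_sq_le (by rw [hT]; linarith)
  have hτ2 : ‖a ⟨x.shift μ, κ⟩‖ ≤ τ := Real.le_sqrt_of_sq_le (by rw [hT]; linarith)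
  have hτ3 : ‖a ⟨x.shift κ, μ⟩‖ ≤ τ := Real.le_sqrt_of_sq_le (by rw [hT]; linarith)
  have hτ4' : ‖a ⟨x, κ⟩‖ ≤ τ := Real.le_sqrt_of_sq_le (by rw [hT]; linarith)
  -- τ ≤ 2 L⁻¹ s ≤ 1/4
  have hLs0 : 0 ≤ (P.L : ℝ)⁻¹ * s := mul_nonneg hLinv0 hs0
  have h4 : T ≤ (2 * ((P.L : ℝ)⁻¹ * s)) ^ 2 := by
    have e1 := pow_le_pow_left₀ (norm_nonneg _) (haL ⟨x, μ⟩) 2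
    have e2 := pow_le_pow_left₀ (norm_nonneg _) (haL ⟨x.shift μ, κ⟩) 2
    have e3 := pow_le_pow_left₀ (norm_nonneg _) (haL ⟨x.shift κ, μ⟩) 2
    have e4 := pow_le_pow_left₀ (norm_nonneg _) (haL ⟨x, κ⟩) 2
    rw [hT]; linarith
  have hτle : τ ≤ 2 * ((P.L : ℝ)⁻¹ * s) :=
    (Real.sqrt_le_sqrt h4).trans (le_of_eq (Real.sqrt_sq (by positivity)))
  have hτ4 : τ ≤ 1 / 4 := by
    have : (P.L : ℝ)⁻¹ * s ≤ 1 / 8 := (mul_le_of_le_one_left hs0 hLinv).trans hs8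
    linarith
  -- the four-factor expansion
  have h1 : dist1 (rect V x μ κ 1 1) ≤ ‖a ⟨x, μ⟩ + a ⟨x.shift μ, κ⟩ - a ⟨x.shift κ, μ⟩ - a ⟨x, κ⟩‖ + 12 * τ ^ 2 := by
    rw [rect_one_one_eq, hVa, hVa, hVa, hVa]
    exact dist1_plaq4_le hτ1 hτ2 hτ3 hτ4' hτ4
  have hτsq : τ ^ 2 = T := Real.sq_sqrt hT0
  have hτ4th : (12 * τ ^ 2) ^ 2 ≤ 576 * ((P.L : ℝ)⁻¹) ^ 2 * s ^ 2 * T := by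
    have hτ0 : 0 ≤ τ := Real.sqrt_nonneg _
    have hτ2 : τ ^ 2 ≤ 4 * ((P.L : ℝ)⁻¹) ^ 2 * s ^ 2 :=
      (pow_le_pow_left₀ hτ0 hτle 2).trans (le_of_eq (by ring))
    calc (12 * τ ^ 2) ^ 2 = 144 * τ ^ 2 * τ ^ 2 := by ring
      _ ≤ 144 * (4 * ((P.L : ℝ)⁻¹) ^ 2 * s ^ 2) * τ ^ 2 :=
          mul_le_mul_of_nonneg_right (mul_le_mul_of_nonneg_left hτ2 (by norm_num)) (sq_nonneg τ)
      _ = 576 * ((P.L : ℝ)⁻¹) ^ 2 * s ^ 2 * T := by rw [hτsq]; ring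
  have hd0 : 0 ≤ dist1 (rect V x μ κ 1 1) := GaugeGroup.dist1_nonneg _
  calc dist1 (rect V x μ κ 1 1) ^ 2 ≤ (‖a ⟨x, μ⟩ + a ⟨x.shift μ, κ⟩ - a ⟨x.shift κ, μ⟩ - a ⟨x, κ⟩‖ + 12 * τ ^ 2) ^ 2 :=
        pow_le_pow_left₀ hd0 h1 2
    _ ≤ 2 * ‖a ⟨x, μ⟩ + a ⟨x.shift μ, κ⟩ - a ⟨x.shift κ, μ⟩ - a ⟨x, κ⟩‖ ^ 2 + 2 * (12 * τ ^ 2) ^ 2 := hsq _ _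
    _ ≤ 2 * ‖a ⟨x, μ⟩ + a ⟨x.shift μ, κ⟩ - a ⟨x.shift κ, μ⟩ - a ⟨x, κ⟩‖ ^ 2 + 2 * (576 * ((P.L : ℝ)⁻¹) ^ 2 * s ^ 2 * T) :=
        add_le_add le_rfl (mul_le_mul_of_nonneg_left hτ4th (by norm_num))
    _ = _ := by rw [hT]; ring

/-- ★★ **ONE COARSE POSITION**: the linearised curl of `A = L⁻¹ • log X` around `(y; μ,κ)` has `‖d A(y)‖² ≤ (L⁻¹)²·(2·arc(R_{μκ}X(y))² + 1152·s²·Σ_{edges} arc(X e)²)`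
(✓`norm_lincurl_logVec_le_arc_add` with the LOCAL size `σ_y := √(Σ_{edges} arc²) ≤ 2s ≤ 1∕4`). [cite: Balaban1985Variational, (34) p.283] -/
theorem sq_norm_lincurl_coarse_le (X : GaugeField P (t + 1) SU2) {s : ℝ} (hs : ∀ e, ‖logVec (su2Quat (X e))‖ ≤ s) (hs8 : s ≤ 1 / 8)
    (y : Site P (t + 1)) (μ κ : Fin P.d) :
    ‖(P.L : ℝ)⁻¹ • logVec (su2Quat (X ⟨y, μ⟩)) + (P.L : ℝ)⁻¹ • logVec (su2Quat (X ⟨y.shift μ, κ⟩))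
        - (P.L : ℝ)⁻¹ • logVec (su2Quat (X ⟨y.shift κ, μ⟩)) - (P.L : ℝ)⁻¹ • logVec (su2Quat (X ⟨y, κ⟩))‖ ^ 2 ≤
      ((P.L : ℝ)⁻¹) ^ 2 * (2 * ‖logVec (su2Quat (rect X y μ κ 1 1))‖ ^ 2 + 1152 * s ^ 2 *
        (‖logVec (su2Quat (X ⟨y, μ⟩))‖ ^ 2 + ‖logVec (su2Quat (X ⟨y.shift μ, κ⟩))‖ ^ 2 +
          ‖logVec (su2Quat (X ⟨y.shift κ, μ⟩))‖ ^ 2 + ‖logVec (su2Quat (X ⟨y, κ⟩))‖ ^ 2)) := by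
  have hsq : ∀ u v : ℝ, (u + v) ^ 2 ≤ 2 * u ^ 2 + 2 * v ^ 2 := fun u v => by nlinarith [sq_nonneg (u - v)]
  have hs0 : 0 ≤ s := (norm_nonneg _).trans (hs ⟨y, μ⟩)
  set S : ℝ := ‖logVec (su2Quat (X ⟨y, μ⟩))‖ ^ 2 + ‖logVec (su2Quat (X ⟨y.shift μ, κ⟩))‖ ^ 2 +
    ‖logVec (su2Quat (X ⟨y.shift κ, μ⟩))‖ ^ 2 + ‖logVec (su2Quat (X ⟨y, κ⟩))‖ ^ 2 with hS
  have hS0 : 0 ≤ S := by positivity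
  set σ : ℝ := Real.sqrt S with hσ
  have q1 := sq_nonneg ‖logVec (su2Quat (X ⟨y, μ⟩))‖; have q2 := sq_nonneg ‖logVec (su2Quat (X ⟨y.shift μ, κ⟩))‖
  have q3 := sq_nonneg ‖logVec (su2Quat (X ⟨y.shift κ, μ⟩))‖; have q4 := sq_nonneg ‖logVec (su2Quat (X ⟨y, κ⟩))‖
  have g1 : ‖logVec (su2Quat (X ⟨y, μ⟩))‖ ≤ σ := Real.le_sqrt_of_sq_le (by rw [hS]; linarith)
  have g2 : ‖logVec (su2Quat (X ⟨y.shift μ, κ⟩))‖ ≤ σ := Real.le_sqrt_of_sq_le (by rw [hS]; linarith)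
  have g3 : ‖logVec (su2Quat (X ⟨y.shift κ, μ⟩))‖ ≤ σ := Real.le_sqrt_of_sq_le (by rw [hS]; linarith)
  have g4 : ‖logVec (su2Quat (X ⟨y, κ⟩))‖ ≤ σ := Real.le_sqrt_of_sq_le (by rw [hS]; linarith)
  have hS4 : S ≤ (2 * s) ^ 2 := by
    have e1 := pow_le_pow_left₀ (norm_nonneg _) (hs ⟨y, μ⟩) 2
    have e2 := pow_le_pow_left₀ (norm_nonneg _) (hs ⟨y.shift μ, κ⟩) 2
    have e3 := pow_le_pow_left₀ (norm_nonneg _) (hs ⟨y.shift κ, μ⟩) 2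
    have e4 := pow_le_pow_left₀ (norm_nonneg _) (hs ⟨y, κ⟩) 2
    rw [hS]; linarith
  have hσle : σ ≤ 2 * s := (Real.sqrt_le_sqrt hS4).trans (le_of_eq (Real.sqrt_sq (by positivity)))
  have hσ4 : σ ≤ 1 / 4 := by linarith
  have h3 := norm_lincurl_logVec_le_arc_add (X ⟨y, μ⟩) (X ⟨y.shift μ, κ⟩) (X ⟨y.shift κ, μ⟩) (X ⟨y, κ⟩) g1 g2 g3 g4 hσ4
  rw [← rect_one_one_eq X y μ κ] at h3
  have hσsq : σ ^ 2 = S := Real.sq_sqrt hS0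
  have hσ4th : (12 * σ ^ 2) ^ 2 ≤ 576 * s ^ 2 * S := by
    have hσ0 : 0 ≤ σ := Real.sqrt_nonneg _
    have hσ2 : σ ^ 2 ≤ 4 * s ^ 2 := (pow_le_pow_left₀ hσ0 hσle 2).trans (le_of_eq (by ring))
    calc (12 * σ ^ 2) ^ 2 = 144 * σ ^ 2 * σ ^ 2 := by ring
      _ ≤ 144 * (4 * s ^ 2) * σ ^ 2 := mul_le_mul_of_nonneg_right (mul_le_mul_of_nonneg_left hσ2 (by norm_num)) (sq_nonneg σ)
      _ = 576 * s ^ 2 * S := by rw [hσsq]; ring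
  have hlin0 : 0 ≤ ‖logVec (su2Quat (X ⟨y, μ⟩)) + logVec (su2Quat (X ⟨y.shift μ, κ⟩)) - logVec (su2Quat (X ⟨y.shift κ, μ⟩)) -
      logVec (su2Quat (X ⟨y, κ⟩))‖ := norm_nonneg _
  rw [← smul_add, ← smul_sub, ← smul_sub, norm_smul, mul_pow, Real.norm_eq_abs, sq_abs]
  refine mul_le_mul_of_nonneg_left ?_ (sq_nonneg _)
  calc _ ≤ (‖logVec (su2Quat (rect X y μ κ 1 1))‖ + 12 * σ ^ 2) ^ 2 := pow_le_pow_left₀ hlin0 h3 2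
    _ ≤ 2 * ‖logVec (su2Quat (rect X y μ κ 1 1))‖ ^ 2 + 2 * (12 * σ ^ 2) ^ 2 := hsq _ _
    _ ≤ 2 * ‖logVec (su2Quat (rect X y μ κ 1 1))‖ ^ 2 + 2 * (576 * s ^ 2 * S) := add_le_add le_rfl (mul_le_mul_of_nonneg_left hσ4th (by norm_num))
    _ = _ := by rw [hS]; ring

/-! ## §3 One ordered pair of directions, summed over the positions of the level -/

/-- ★★★ **ONE PLANE, ONE LEVEL, IN `ℓ²`**: for `μ ≠ κ`,
`Σ_x dist1 (R_{μκ}V(x))² ≤ 4·L^{d−4}·Σ_y arc(R_{μκ}X(y))² + 2304·L^{d−4}·s²·Σ_y (arc(X⟨y,μ⟩)² + arc(X⟨y,κ⟩)²)·2 + 2304·(L⁻¹)²·s²·Σ_x (‖a⟨x,μ⟩‖² + ‖a⟨x,κ⟩‖²)`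
— the FLUX term with the `L^{d−4}` gain, and two SIZE² terms linear in the LOCAL squared sizes. [cite: Balaban1985RegularSpaces, (1.29) p.81] -/
theorem sum_dist1_rect_lift_sq_le (ht : t + 1 ≤ P.m + P.K) (w : PBond P t → PBond P (t + 1) → ℝ)
    (hw : ∀ b e, w b e = if e.dir = b.dir ∧ (b.src b.dir - emb e.src b.dir).val < P.L then
      ∏ ν ∈ Finset.univ.erase b.dir, max 0 (1 - ((rel (emb e.src) b.src ν).natAbs : ℝ) / P.L) else 0)
    (X : GaugeField P (t + 1) SU2) (V : GaugeField P t SU2)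
    (hV : ∀ b, V b = expPoint (∑ e, w b e • ((P.L : ℝ)⁻¹ • logVec (su2Quat (X e)))))
    {s : ℝ} (hs : ∀ e, ‖logVec (su2Quat (X e))‖ ≤ s) (hs8 : s ≤ 1 / 8) {μ κ : Fin P.d} (hμκ : μ ≠ κ) :
    ∑ x : Site P t, dist1 (rect V x μ κ 1 1) ^ 2 ≤
      ((P.L : ℝ)⁻¹) ^ 2 * (P.L : ℝ) ^ P.d * (((P.L : ℝ)⁻¹) ^ 2 * (4 * ∑ y : Site P (t + 1), ‖logVec (su2Quat (rect X y μ κ 1 1))‖ ^ 2 +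
        4608 * s ^ 2 * ∑ y : Site P (t + 1), (‖logVec (su2Quat (X ⟨y, μ⟩))‖ ^ 2 + ‖logVec (su2Quat (X ⟨y, κ⟩))‖ ^ 2))) +
      2304 * ((P.L : ℝ)⁻¹) ^ 2 * s ^ 2 * ∑ x : Site P t, (‖∑ e, w ⟨x, μ⟩ e • ((P.L : ℝ)⁻¹ • logVec (su2Quat (X e)))‖ ^ 2 +
        ‖∑ e, w ⟨x, κ⟩ e • ((P.L : ℝ)⁻¹ • logVec (su2Quat (X e)))‖ ^ 2) := by
  -- the fine positions, one by one
  have h1 := fun x => dist1_rect_lift_sq_le ht w hw X V hV hs hs8 x μ κ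
  -- the exponent field `a` and the coarse form `A`
  set a : PBond P t → EuclideanSpace ℝ (Fin 3) := fun b => ∑ e, w b e • ((P.L : ℝ)⁻¹ • logVec (su2Quat (X e))) with ha
  set A : PBond P (t + 1) → EuclideanSpace ℝ (Fin 3) := fun e => (P.L : ℝ)⁻¹ • logVec (su2Quat (X e)) with hA
  have hcurl := sum_sq_norm_lincurl_hat_le ht w hw A a (fun _ => rfl) hμκ
  have h2 := fun y => sq_norm_lincurl_coarse_le X hs hs8 y μ κ
  have hL2 : 0 ≤ ((P.L : ℝ)⁻¹) ^ 2 * (P.L : ℝ) ^ P.d := by positivity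
  calc ∑ x : Site P t, dist1 (rect V x μ κ 1 1) ^ 2
      ≤ ∑ x : Site P t, (2 * ‖a ⟨x, μ⟩ + a ⟨x.shift μ, κ⟩ - a ⟨x.shift κ, μ⟩ - a ⟨x, κ⟩‖ ^ 2 +
          1152 * ((P.L : ℝ)⁻¹) ^ 2 * s ^ 2 * (‖a ⟨x, μ⟩‖ ^ 2 + ‖a ⟨x.shift μ, κ⟩‖ ^ 2 + ‖a ⟨x.shift κ, μ⟩‖ ^ 2 + ‖a ⟨x, κ⟩‖ ^ 2)) :=
        Finset.sum_le_sum fun x _ => h1 x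
    _ = 2 * ∑ x : Site P t, ‖a ⟨x, μ⟩ + a ⟨x.shift μ, κ⟩ - a ⟨x.shift κ, μ⟩ - a ⟨x, κ⟩‖ ^ 2 +
          1152 * ((P.L : ℝ)⁻¹) ^ 2 * s ^ 2 * (2 * ∑ x : Site P t, (‖a ⟨x, μ⟩‖ ^ 2 + ‖a ⟨x, κ⟩‖ ^ 2)) := by
        rw [Finset.sum_add_distrib, ← Finset.mul_sum, ← Finset.mul_sum, sum_four_slots_eq (fun b => ‖a b‖ ^ 2) μ κ]
    _ ≤ 2 * (((P.L : ℝ)⁻¹) ^ 2 * (P.L : ℝ) ^ P.d * ∑ y : Site P (t + 1), ‖A ⟨y, μ⟩ + A ⟨y.shift μ, κ⟩ - A ⟨y.shift κ, μ⟩ - A ⟨y, κ⟩‖ ^ 2) +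
          1152 * ((P.L : ℝ)⁻¹) ^ 2 * s ^ 2 * (2 * ∑ x : Site P t, (‖a ⟨x, μ⟩‖ ^ 2 + ‖a ⟨x, κ⟩‖ ^ 2)) := by
        gcongr
    _ ≤ 2 * (((P.L : ℝ)⁻¹) ^ 2 * (P.L : ℝ) ^ P.d * ∑ y : Site P (t + 1), ((P.L : ℝ)⁻¹) ^ 2 * (2 * ‖logVec (su2Quat (rect X y μ κ 1 1))‖ ^ 2 +
          1152 * s ^ 2 * (‖logVec (su2Quat (X ⟨y, μ⟩))‖ ^ 2 + ‖logVec (su2Quat (X ⟨y.shift μ, κ⟩))‖ ^ 2 +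
            ‖logVec (su2Quat (X ⟨y.shift κ, μ⟩))‖ ^ 2 + ‖logVec (su2Quat (X ⟨y, κ⟩))‖ ^ 2))) +
          1152 * ((P.L : ℝ)⁻¹) ^ 2 * s ^ 2 * (2 * ∑ x : Site P t, (‖a ⟨x, μ⟩‖ ^ 2 + ‖a ⟨x, κ⟩‖ ^ 2)) := by
        gcongr with y _
        exact h2 y
    _ = _ := by
        have hE := sum_four_slots_eq (fun e : PBond P (t + 1) => ‖logVec (su2Quat (X e))‖ ^ 2) μ κ
        have hinner : ∑ y : Site P (t + 1), ((P.L : ℝ)⁻¹) ^ 2 * (2 * ‖logVec (su2Quat (rect X y μ κ 1 1))‖ ^ 2 +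
            1152 * s ^ 2 * (‖logVec (su2Quat (X ⟨y, μ⟩))‖ ^ 2 + ‖logVec (su2Quat (X ⟨y.shift μ, κ⟩))‖ ^ 2 +
              ‖logVec (su2Quat (X ⟨y.shift κ, μ⟩))‖ ^ 2 + ‖logVec (su2Quat (X ⟨y, κ⟩))‖ ^ 2))
            = ((P.L : ℝ)⁻¹) ^ 2 * (2 * ∑ y : Site P (t + 1), ‖logVec (su2Quat (rect X y μ κ 1 1))‖ ^ 2 +
              1152 * s ^ 2 * (2 * ∑ y : Site P (t + 1), (‖logVec (su2Quat (X ⟨y, μ⟩))‖ ^ 2 + ‖logVec (su2Quat (X ⟨y, κ⟩))‖ ^ 2))) := by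
          rw [← hE, ← Finset.mul_sum, Finset.sum_add_distrib, ← Finset.mul_sum, ← Finset.mul_sum]
        rw [hinner]
        ring

/-! ## §4 All ordered pairs of directions: the level in `ℓ²` -/

/-- The exponents' squared sizes, summed over a level with the hat masses: `Σ_b Σ_e w b e · arc(X e)² = L^d · Σ_e arc(X e)²`. [folklore] -/
theorem sum_sum_hatW_mul_eq (ht : t + 1 ≤ P.m + P.K) (w : PBond P t → PBond P (t + 1) → ℝ)
    (hw : ∀ b e, w b e = if e.dir = b.dir ∧ (b.src b.dir - emb e.src b.dir).val < P.L then
      ∏ ν ∈ Finset.univ.erase b.dir, max 0 (1 - ((rel (emb e.src) b.src ν).natAbs : ℝ) / P.L) else 0)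
    (G : PBond P (t + 1) → ℝ) : ∑ b : PBond P t, ∑ e, w b e * G e = (P.L : ℝ) ^ P.d * ∑ e, G e := by
  rw [Finset.sum_comm, Finset.mul_sum]
  exact Finset.sum_congr rfl fun e _ => by rw [← Finset.sum_mul, sum_hatW_eq_pow ht w hw e]

/-- ★★★ **THE CURVATURE OF THE HAT LIFT IN `ℓ²` OVER A LEVEL** (all ordered plaquette positions): with every coarse bond `s`-small (`s ≤ 1∕8`),
`Σ_{(x;μ≠κ)} dist1 (R_{μκ}V(x))² ≤ (L⁻¹)⁴·L^d · (4·Σ_{(y;μ≠κ)} arc(R_{μκ}X(y))² + 13824·(d−1)·s²·Σ_e arc(X e)²)` — the `L^{d−4}` (= `L⁻¹` in `d = 3`) GAIN on the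
coarse FLUX plus the SIZE² term LINEAR in the coarse field's `ℓ²`-size (`s × B_{t+1}` in §57.8 (B)'s currency — the summable `e_j` slot of px17's (H)). [cite: Balaban1985RegularSpaces, (1.29) p.81] -/
theorem sum_positions_dist1_lift_sq_le (ht : t + 1 ≤ P.m + P.K) (w : PBond P t → PBond P (t + 1) → ℝ)
    (hw : ∀ b e, w b e = if e.dir = b.dir ∧ (b.src b.dir - emb e.src b.dir).val < P.L then
      ∏ ν ∈ Finset.univ.erase b.dir, max 0 (1 - ((rel (emb e.src) b.src ν).natAbs : ℝ) / P.L) else 0)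
    (X : GaugeField P (t + 1) SU2) (V : GaugeField P t SU2)
    (hV : ∀ b, V b = expPoint (∑ e, w b e • ((P.L : ℝ)⁻¹ • logVec (su2Quat (X e)))))
    {s : ℝ} (hs : ∀ e, ‖logVec (su2Quat (X e))‖ ≤ s) (hs8 : s ≤ 1 / 8) :
    ∑ q ∈ (Finset.univ : Finset (Site P t × Fin P.d × Fin P.d)).filter (fun q => q.2.1 ≠ q.2.2), dist1 (rect V q.1 q.2.1 q.2.2 1 1) ^ 2 ≤
      (((P.L : ℝ)⁻¹) ^ 2) ^ 2 * (P.L : ℝ) ^ P.d *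
        (4 * ∑ q ∈ (Finset.univ : Finset (Site P (t + 1) × Fin P.d × Fin P.d)).filter (fun q => q.2.1 ≠ q.2.2),
            ‖logVec (su2Quat (rect X q.1 q.2.1 q.2.2 1 1))‖ ^ 2 +
          13824 * ((P.d : ℝ) - 1) * s ^ 2 * ∑ e, ‖logVec (su2Quat (X e))‖ ^ 2) := by
  -- per plane
  have hplane := fun (μ κ : Fin P.d) (hμκ : μ ≠ κ) => sum_dist1_rect_lift_sq_le ht w hw X V hV hs hs8 hμκ
  have hexp : ∀ b : PBond P t, ‖∑ e, w b e • ((P.L : ℝ)⁻¹ • logVec (su2Quat (X e)))‖ ^ 2 ≤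
      ((P.L : ℝ)⁻¹) ^ 2 * ∑ e, w b e * ‖logVec (su2Quat (X e))‖ ^ 2 := fun b => sq_norm_exponent_le ht w hw X b
  -- the two SIZE² sums over the planes
  have eP : ∑ p ∈ (Finset.univ : Finset (Fin P.d × Fin P.d)).filter (fun p => p.1 ≠ p.2),
      ∑ y : Site P (t + 1), (‖logVec (su2Quat (X ⟨y, p.1⟩))‖ ^ 2 + ‖logVec (su2Quat (X ⟨y, p.2⟩))‖ ^ 2) =
      2 * ((P.d : ℝ) - 1) * ∑ e : PBond P (t + 1), ‖logVec (su2Quat (X e))‖ ^ 2 := by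
    calc _ = ∑ p ∈ (Finset.univ : Finset (Fin P.d × Fin P.d)).filter (fun p => p.1 ≠ p.2),
          ((∑ y : Site P (t + 1), ‖logVec (su2Quat (X ⟨y, p.1⟩))‖ ^ 2) + ∑ y : Site P (t + 1), ‖logVec (su2Quat (X ⟨y, p.2⟩))‖ ^ 2) :=
          Finset.sum_congr rfl fun p _ => Finset.sum_add_distrib
      _ = 2 * ((P.d : ℝ) - 1) * ∑ μ : Fin P.d, ∑ y : Site P (t + 1), ‖logVec (su2Quat (X ⟨y, μ⟩))‖ ^ 2 :=
          sum_pairs_add_eq (fun μ => ∑ y : Site P (t + 1), ‖logVec (su2Quat (X ⟨y, μ⟩))‖ ^ 2)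
      _ = _ := by
          rw [FluctuationComparisonRegPrIntLS2BetaWhitneyHatWeights.sum_pbond (fun e : PBond P (t + 1) => ‖logVec (su2Quat (X e))‖ ^ 2),
            Finset.sum_comm]
  have eQ : ∑ p ∈ (Finset.univ : Finset (Fin P.d × Fin P.d)).filter (fun p => p.1 ≠ p.2),
      ∑ x : Site P t, (∑ e, w ⟨x, p.1⟩ e * ‖logVec (su2Quat (X e))‖ ^ 2 + ∑ e, w ⟨x, p.2⟩ e * ‖logVec (su2Quat (X e))‖ ^ 2) =
      2 * ((P.d : ℝ) - 1) * ((P.L : ℝ) ^ P.d * ∑ e : PBond P (t + 1), ‖logVec (su2Quat (X e))‖ ^ 2) := by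
    calc _ = ∑ p ∈ (Finset.univ : Finset (Fin P.d × Fin P.d)).filter (fun p => p.1 ≠ p.2),
          ((∑ x : Site P t, ∑ e, w ⟨x, p.1⟩ e * ‖logVec (su2Quat (X e))‖ ^ 2) + ∑ x : Site P t, ∑ e, w ⟨x, p.2⟩ e * ‖logVec (su2Quat (X e))‖ ^ 2) :=
          Finset.sum_congr rfl fun p _ => Finset.sum_add_distrib
      _ = 2 * ((P.d : ℝ) - 1) * ∑ μ : Fin P.d, ∑ x : Site P t, ∑ e, w ⟨x, μ⟩ e * ‖logVec (su2Quat (X e))‖ ^ 2 :=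
          sum_pairs_add_eq (fun μ => ∑ x : Site P t, ∑ e, w ⟨x, μ⟩ e * ‖logVec (su2Quat (X e))‖ ^ 2)
      _ = _ := by
          rw [← sum_sum_hatW_mul_eq ht w hw,
            FluctuationComparisonRegPrIntLS2BetaWhitneyHatWeights.sum_pbond (fun b : PBond P t => ∑ e, w b e * ‖logVec (su2Quat (X e))‖ ^ 2),
            Finset.sum_comm]
  rw [sum_positions_eq, sum_positions_eq]
  calc ∑ p ∈ (Finset.univ : Finset (Fin P.d × Fin P.d)).filter (fun p => p.1 ≠ p.2), ∑ x : Site P t, dist1 (rect V x p.1 p.2 1 1) ^ 2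
      ≤ ∑ p ∈ (Finset.univ : Finset (Fin P.d × Fin P.d)).filter (fun p => p.1 ≠ p.2),
          (((P.L : ℝ)⁻¹) ^ 2 * (P.L : ℝ) ^ P.d * (((P.L : ℝ)⁻¹) ^ 2 * (4 * ∑ y : Site P (t + 1), ‖logVec (su2Quat (rect X y p.1 p.2 1 1))‖ ^ 2 +
            4608 * s ^ 2 * ∑ y : Site P (t + 1), (‖logVec (su2Quat (X ⟨y, p.1⟩))‖ ^ 2 + ‖logVec (su2Quat (X ⟨y, p.2⟩))‖ ^ 2))) +
          2304 * ((P.L : ℝ)⁻¹) ^ 2 * s ^ 2 * (((P.L : ℝ)⁻¹) ^ 2 * ∑ x : Site P t,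
            (∑ e, w ⟨x, p.1⟩ e * ‖logVec (su2Quat (X e))‖ ^ 2 + ∑ e, w ⟨x, p.2⟩ e * ‖logVec (su2Quat (X e))‖ ^ 2))) := by
        refine Finset.sum_le_sum fun p hp => ?_
        have hμκ : p.1 ≠ p.2 := (Finset.mem_filter.mp hp).2
        have hc : (0 : ℝ) ≤ 2304 * ((P.L : ℝ)⁻¹) ^ 2 * s ^ 2 := by positivity
        refine (hplane p.1 p.2 hμκ).trans (add_le_add le_rfl (mul_le_mul_of_nonneg_left ?_ hc))
        rw [Finset.mul_sum]
        exact Finset.sum_le_sum fun x _ => by rw [mul_add]; exact add_le_add (hexp _) (hexp _)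
    _ = ((P.L : ℝ)⁻¹) ^ 2 * (P.L : ℝ) ^ P.d * ((P.L : ℝ)⁻¹) ^ 2 * 4 *
            ∑ p ∈ (Finset.univ : Finset (Fin P.d × Fin P.d)).filter (fun p => p.1 ≠ p.2), ∑ y : Site P (t + 1), ‖logVec (su2Quat (rect X y p.1 p.2 1 1))‖ ^ 2 +
          ((P.L : ℝ)⁻¹) ^ 2 * (P.L : ℝ) ^ P.d * ((P.L : ℝ)⁻¹) ^ 2 * (4608 * s ^ 2) *
            ∑ p ∈ (Finset.univ : Finset (Fin P.d × Fin P.d)).filter (fun p => p.1 ≠ p.2),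
              ∑ y : Site P (t + 1), (‖logVec (su2Quat (X ⟨y, p.1⟩))‖ ^ 2 + ‖logVec (su2Quat (X ⟨y, p.2⟩))‖ ^ 2) +
          2304 * ((P.L : ℝ)⁻¹) ^ 2 * s ^ 2 * ((P.L : ℝ)⁻¹) ^ 2 *
            ∑ p ∈ (Finset.univ : Finset (Fin P.d × Fin P.d)).filter (fun p => p.1 ≠ p.2),
              ∑ x : Site P t, (∑ e, w ⟨x, p.1⟩ e * ‖logVec (su2Quat (X e))‖ ^ 2 + ∑ e, w ⟨x, p.2⟩ e * ‖logVec (su2Quat (X e))‖ ^ 2) := by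
        rw [Finset.mul_sum, Finset.mul_sum, Finset.mul_sum, ← Finset.sum_add_distrib, ← Finset.sum_add_distrib]
        exact Finset.sum_congr rfl fun p _ => by ring
    _ = _ := by rw [eP, eQ]; ring

/-! ## §5 On the tree's plaquettes: `‖dist1 (V(∂·))‖²_{ℓ²} ≤ L^{d−4}·(π²·‖dist1 (X(∂·))‖²_{ℓ²} + 6912(d−1)·s²·‖arc X‖²_{ℓ²})` -/

/-- The position sum of squared ARCS of the unit rectangles is at most `(π∕2)² × 2 ×` the plaquette sum of squared CHORDS (Jordan + ✓`sum_positions_sq_eq_two_mul_sum_plaq`).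
[folklore] -/
theorem sum_positions_arc_sq_le {s : ℕ} (X : GaugeField P s SU2) :
    ∑ q ∈ (Finset.univ : Finset (Site P s × Fin P.d × Fin P.d)).filter (fun q => q.2.1 ≠ q.2.2), ‖logVec (su2Quat (rect X q.1 q.2.1 q.2.2 1 1))‖ ^ 2 ≤
      (π / 2) ^ 2 * (2 * ∑ p : Plaq P s, dist1 (GaugeField.plaqHol X p) ^ 2) := by
  rw [← sum_positions_sq_eq_two_mul_sum_plaq X, Finset.mul_sum]
  refine Finset.sum_le_sum fun q _ => ?_
  rw [← mul_pow]
  exact pow_le_pow_left₀ (norm_nonneg _) (norm_logVec_le_pi_div_two_mul_dist1 _) 2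

/-- ★★★ **THE CURVATURE OF THE HAT LIFT IN `ℓ²(Plaq P t)`** — the (F3) feeder of px17 g19's (H) (✓p816498), V-plaquette half of px13 g22's ✓`sq_sum_le_plaq`
(`Σ_p dist1 (plaqHol U₀ p)²` with `U₀ := V`): with every coarse bond `s`-small (`s ≤ 1∕8`),
`Σ_{p : Plaq P t} dist1 (V(∂p))² ≤ (L⁻¹)⁴·L^d·(π²·Σ_{p′ : Plaq P (t+1)} dist1 (X(∂p′))² + 6912·(d−1)·s²·Σ_e arc(X e)²)` — in `d = 3`: `L⁻¹ ×` (coarse plaquette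
energy + `s² ×` coarse bond energy): the FLUX part feeds the KEY LEMMA chain, the SIZE² part is `√L·e_t·B_{t+1}` with `e_t ∝ s_{t+1}∕L` SUMMABLE along the contracting
relative tower (✓p816141 (5)). [cite: Balaban1985RegularSpaces, (1.29) p.81] -/
theorem sum_plaq_dist1_lift_sq_le (ht : t + 1 ≤ P.m + P.K) (w : PBond P t → PBond P (t + 1) → ℝ)
    (hw : ∀ b e, w b e = if e.dir = b.dir ∧ (b.src b.dir - emb e.src b.dir).val < P.L then
      ∏ ν ∈ Finset.univ.erase b.dir, max 0 (1 - ((rel (emb e.src) b.src ν).natAbs : ℝ) / P.L) else 0)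
    (X : GaugeField P (t + 1) SU2) (V : GaugeField P t SU2)
    (hV : ∀ b, V b = expPoint (∑ e, w b e • ((P.L : ℝ)⁻¹ • logVec (su2Quat (X e)))))
    {s : ℝ} (hs : ∀ e, ‖logVec (su2Quat (X e))‖ ≤ s) (hs8 : s ≤ 1 / 8) :
    ∑ p : Plaq P t, dist1 (GaugeField.plaqHol V p) ^ 2 ≤
      (((P.L : ℝ)⁻¹) ^ 2) ^ 2 * (P.L : ℝ) ^ P.d *
        (π ^ 2 * ∑ p : Plaq P (t + 1), dist1 (GaugeField.plaqHol X p) ^ 2 + 6912 * ((P.d : ℝ) - 1) * s ^ 2 * ∑ e, ‖logVec (su2Quat (X e))‖ ^ 2) := by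
  have h := sum_positions_dist1_lift_sq_le ht w hw X V hV hs hs8
  rw [sum_positions_sq_eq_two_mul_sum_plaq V] at h
  have hX := sum_positions_arc_sq_le (P := P) X
  have hc : 0 ≤ (((P.L : ℝ)⁻¹) ^ 2) ^ 2 * (P.L : ℝ) ^ P.d := by positivity
  have h2 : 2 * ∑ p : Plaq P t, dist1 (GaugeField.plaqHol V p) ^ 2 ≤
      (((P.L : ℝ)⁻¹) ^ 2) ^ 2 * (P.L : ℝ) ^ P.d *
        (4 * ((π / 2) ^ 2 * (2 * ∑ p : Plaq P (t + 1), dist1 (GaugeField.plaqHol X p) ^ 2)) +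
          13824 * ((P.d : ℝ) - 1) * s ^ 2 * ∑ e, ‖logVec (su2Quat (X e))‖ ^ 2) :=
    h.trans (mul_le_mul_of_nonneg_left (by linarith) hc)
  nlinarith [h2]

end Summit.QuantumFields.YangMills.Theorems.FluctuationComparisonRegPrIntLS2BetaWhitneyHatLiftCurvatureSq

end
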